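/-
Copyright (c) 2026 the pub-hodgecm-mathlib formalisation cell (harness21).  Prover seat hodgecm-mathlib-K2E4-p08 (g2), Track B «K2-LIT» ∕ h413, ‹S› ROAD J brick J1′, rung 4:
the constant value of `Δ‴_v` on the `ε′`-side near the centre IS `Δ‴_v(ε_H, ε′)`.  2026-09-04.
-/
import Literature.NumberTheory.Rogawski1990.FinExplicitTransferFactorBadFrameConstancy   -- ★ p842237 A-p16 (g26): `hΔ′` with an anonymous constant; this file names it
import HarnessLib

/-!
# `Δ‴_v` on the matched `ε′`-side classes near `ε_H` equals `Δ‴_v(ε_H, ε′)` — road J brick J1′, rung 4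

★ `exists_const_nhds_finExplicitCollection_Δ_eq_of_frame` (p842237; [Rogawski1990, §4.9 p. 55, §8.2 Prop. 8.2.1 (a)], [LanglandsShelstad1987, §1]) gives `∃ Δ₁` with
`Δ‴_v(γ_H, c) = Δ₁` for `G`-regular `γ_H` near `ε_H = (a·1₂, u)` and every matched `P′`-framed class `c`; its proof exhibits `Δ₁ = τ(ε_H)·D(ε_H)·κ(P′e₃)`.  For the SIGN of the
singular transfer (road J) the constant must be NAMED: with the framed second class `ε′` (`ε′·P′ = P′·(a·1₂ ⊕ᶠ u)`, matched with `ε_H`) the same three readings at the centre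
(`τ`, `D` are defined at `ε_H` since `χ_{a·1}(u) ≠ 0`, ★ `isUnit_eval_finCharpolyTwo_of_central`; `κ(ε_H, ε′)` is read on the eigenvector `P′e₃` of `ε′`, ★
`finKappaAt_eq_ite_of_eigenvector`) give **`Δ₁ = Δ‴_v(ε_H, ε′)`**; and then ★ `finExplicitDelta_eq_neg_of_not_isConj_of_fst_eq_smul_one` yields `Δ‴_v(ε_H, ε′) = −Δ‴_v(ε_H, ε)`
for the two central classes — the Kottwitz sign flip between the two sheets [Rogawski1990, §8.2 pp. 117–122].

* **`exists_nhds_finExplicitCollection_Δ_eq_secondClass_of_frame`**.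

HONEST LABEL: a Literature-side helper toward h413 (`stmt-HodgeConjecture-24833`); HC_CM is proved only modulo its printed citations until rung 0 closes.
-/

set_option autoImplicit false

noncomputable section

open Set Filter Topology Matrix Polynomial NumberField IsDedekindDomain
open scoped MatrixGroups

namespace Literature.NumberTheory.Rogawski1990

open Literature.NumberTheory.Automorphic Literature.NumberTheory.Automorphic.UnitaryGroup Literature.NumberTheory.GaloisRepresentations

section BadFrameValue

variable (L : Type) [Field L] [NumberField L] [IsCMField L] (H' : Matrix (Fin 3) (Fin 3) L) (v : HeightOneSpectrum (𝓞 ↥(maximalRealSubfield L)))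

omit [NumberField L] [IsCMField L] in
/-- **`(B ⊕ᶠ D)·e₃ = D₀₀·e₃`**: the last basis vector is an eigenvector of a `2 ⊕ 1` block matrix. [cite: Rogawski1990, §4.8 Case (a) p. 53] -/
private theorem finSum_two_one_mulVec_single_two₂ {R : Type} [CommRing R] (B : Matrix (Fin 2) (Fin 2) R) (D : Matrix (Fin 1) (Fin 1) R) :
    finSum 2 1 B D *ᵥ Pi.single (2 : Fin (2 + 1)) (1 : R) = (D 0 0) • Pi.single (2 : Fin (2 + 1)) (1 : R) := by
  have h1 : (Pi.single (2 : Fin (2 + 1)) (1 : R)) = Fin.append (0 : Fin 2 → R) (fun _ : Fin 1 => (1 : R)) := by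
    ext i; fin_cases i <;> rfl
  have h2 : ((D 0 0) • Pi.single (2 : Fin (2 + 1)) (1 : R)) = Fin.append (0 : Fin 2 → R) (fun _ : Fin 1 => D 0 0) := by
    ext i; fin_cases i <;> simp [Fin.append, Fin.addCases]
  rw [h2, h1, finSum_mulVec_append, Matrix.mulVec_zero]
  congr 1
  ext i
  have hi : i = 0 := Subsingleton.elim _ _
  subst hi
  simp [Matrix.mulVec, dotProduct]

omit [NumberField L] [IsCMField L] in
/-- An invertible matrix kills no non-zero vector. [folklore] -/
private theorem mulVec_ne_zero_of_ne_zero₂ {n : Type} [Fintype n] [DecidableEq n] {R : Type} [CommRing R] (g : GL n R) {p : n → R} (hp : p ≠ 0) :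
    g.val *ᵥ p ≠ 0 := by
  intro h0
  apply hp
  have h1 : (g⁻¹).val *ᵥ (g.val *ᵥ p) = p := by
    rw [mulVec_mulVec, ← Units.val_mul, inv_mul_cancel, Units.val_one, one_mulVec]
  rw [← h1, h0, mulVec_zero]

open scoped Classical in
/-- **`Δ‴_v` ON THE MATCHED `ε′`-SIDE CLASSES NEAR `ε_H` IS `Δ‴_v(ε_H, ε′)`** — ★ `exists_const_nhds_finExplicitCollection_Δ_eq_of_frame` with its constant IDENTIFIED
as the explicit factor at the centre and the framed second class `ε′` (`ε′·P′ = P′·(a·1₂ ⊕ᶠ u)`, matched with `ε_H`): both read `τ(ε_H)·D(ε_H)·κ`, `κ` the sign of the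
hermitian length of the common eigenvector `P′e₃`. [cite: Rogawski1990, §4.9 p. 55; §4.3 (4.3.2) p. 43; §8.2 Prop. 8.2.1 (a) p. 112] [cite: LanglandsShelstad1987, §1] -/
theorem exists_nhds_finExplicitCollection_Δ_eq_secondClass_of_frame (w : PlacesOver L v) (hw : IsCMField.complexConj L • w.1 = w.1) (μ : HeckeCharacter L)
    (εH : ((cmDatum L 2 (Matrix.of fun i j : Fin 2 => if i.val + j.val + 1 = 2 then (1 : L) else 0)).Local v ×
      (cmDatum L 1 (Matrix.of fun i j : Fin 1 => if i.val + j.val + 1 = 1 then (1 : L) else 0)).Local v)) (a : LocalRing L v)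
    (ha : (εH.1.val.val : Matrix (Fin 2) (Fin 2) (LocalRing L v)) = a • (1 : Matrix (Fin 2) (Fin 2) (LocalRing L v)))
    (hu : (εH.2.val.val : Matrix (Fin 1) (Fin 1) (LocalRing L v)) 0 0 ≠ a)
    (P' : GL (Fin (2 + 1)) (LocalRing L v)) (ε' : (cmDatum L 3 H').Local v)
    (hε' : (ε'.val.val : Matrix (Fin 3) (Fin 3) (LocalRing L v)) * P'.val =
      P'.val * finSum 2 1 (a • (1 : Matrix (Fin 2) (Fin 2) (LocalRing L v))) (εH.2.val.val : Matrix (Fin 1) (Fin 1) (LocalRing L v)))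
    (hmatch : IsLocalNormPair L H' v εH ε') :
    ∃ VΔ ∈ 𝓝 εH, ∀ γH ∈ VΔ, IsLocalGRegular L v γH → ∀ c : ConjClasses ((cmDatum L 3 H').Local v), (∃ x : ((cmDatum L 3 H').Local v), (∃ B : Matrix (Fin 2) (Fin 2) (LocalRing L v), ((x * Quotient.out c * x⁻¹).val.val : Matrix (Fin 3) (Fin 3) (LocalRing L v)) * P'.val = P'.val * finSum 2 1 B (γH.2.val.val : Matrix (Fin 1) (Fin 1) (LocalRing L v)))) →
        IsLocalNormPair L H' v γH (Quotient.out c) → ((finExplicitCollection L H' μ (finExplicitDelta_conj_left_all L H' μ) (finExplicitDelta_conj_right_all L H' μ)) v).Δ γH (Quotient.out c) = finExplicitDelta L v H' εH μ ε' := by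
  haveI hv : Subsingleton (PlacesOver L v) := PlacesOver.subsingleton_of_smul_eq (IsCMField.complexConj L) (IsCMField.complexConj_ne_one L) w hw
  have hu₀ : IsUnit ((finCharpolyTwo L v εH).eval (finGammaTwo L v εH)) := isUnit_eval_finCharpolyTwo_of_central L v w hw εH a ha hu
  -- `τ`, `D` eventually constant at `ε_H`
  obtain ⟨VΔ, hVΔ, hV⟩ := ((finTau_eventually_eq L v μ hu₀).and (finWeylRatio_eventually_eq L v hu₀)).exists_mem
  -- the fixed vector `P′ e₃` and the sign `κ₀` read on it
  set p' : Fin 3 → LocalRing L v := P'.val *ᵥ Pi.single (2 : Fin (2 + 1)) (1 : LocalRing L v) with hp'def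
  have hne : p' ≠ 0 := mulVec_ne_zero_of_ne_zero₂ P' (by simp)
  -- the value at the centre: `Δ‴(ε_H, ε′) = τ(ε_H)·D(ε_H)·κ(P′e₃)`
  have hpε : ((ε'.val.val : Matrix (Fin 3) (Fin 3) (LocalRing L v))) *ᵥ p' = finGammaTwo L v εH • p' := by
    rw [hp'def, mulVec_mulVec, hε', ← mulVec_mulVec, finSum_two_one_mulVec_single_two₂, mulVec_smul]
    rfl
  have hΔε : finExplicitDelta L v H' εH μ ε' = finTau L v εH μ * (finWeylRatio L v εH : ℂ) *
      (((if ∃ z : LocalRing L v, IsUnit z ∧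
          (∑ i : Fin 3, ∑ k : Fin 3, conjLocal L (IsCMField.complexConj L) v (p' i) *
            ((adelicForm L 3 H').map (adeleToLocal L v)) i k * p' k) =
          z * conjLocal L (IsCMField.complexConj L) v z then (1 : ℤ) else -1 : ℤ) : ℂ)) := by
    rw [finExplicitDelta_of_isLocalNormPair L v H' εH μ hmatch, finKappaAt_eq_ite_of_eigenvector L v H' εH ε' hv hmatch hu₀ hpε hne]
  refine ⟨VΔ, hVΔ, ?_⟩
  rintro γH hγ hreg c ⟨x, B, hxB⟩ hm
  obtain ⟨hτ, hD⟩ := hV γH hγ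
  -- move to the conjugate `b := x·(out c)·x⁻¹` in the frame
  have hmb : IsLocalNormPair L H' v γH (x * Quotient.out c * x⁻¹) :=
    (isLocalNormPair_conj_right (L := L) (v := v) (H' := H') (a := γH) (b := Quotient.out c) (y := x)).2 hm
  have hΔ : ((finExplicitCollection L H' μ (finExplicitDelta_conj_left_all L H' μ) (finExplicitDelta_conj_right_all L H' μ)) v).Δ γH (Quotient.out c) =
      finExplicitDelta L v H' γH μ (x * Quotient.out c * x⁻¹) := by
    rw [finExplicitCollection_Δ, finExplicitDelta_conj_right_all L H' μ v γH (Quotient.out c) x]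
  -- the common eigenvector `P′ e₃`, eigenvalue `u(γ_H)`
  have hp : ((x * Quotient.out c * x⁻¹).val.val : Matrix (Fin 3) (Fin 3) (LocalRing L v)) *ᵥ p' = finGammaTwo L v γH • p' := by
    rw [hp'def, mulVec_mulVec, hxB, ← mulVec_mulVec, finSum_two_one_mulVec_single_two₂, mulVec_smul]
    rfl
  have hκ := finKappaAt_eq_ite_of_eigenvector L v H' γH (x * Quotient.out c * x⁻¹) hv hmb
    (isUnit_eval_finCharpolyTwo_of_isLocalGRegular (L := L) (v := v) (a := γH) hreg) hp hne
  rw [hΔ, finExplicitDelta_of_isLocalNormPair L v H' γH μ hmb, hτ, hD, hκ, hΔε]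

end BadFrameValue

end Literature.NumberTheory.Rogawski1990

end
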